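import Summits.AtomisticToContinuum.Crystallization.Theorems.RepetitiveNetworkReductionRecurrentMemberDefs

/-!
# `NetworkRecurrenceTransfer.stub_recurrentMember` — part 3/4: field sums and closure of `Appr` / Nash under rooted local limits

Registered stub `stub_recurrentMember` of `NetworkRecurrenceTransfer` (RED, `stmt-AtomisticToContinuum-27236`,
route `RepetitiveNetworkReduction`, sub-problem `Crystallization` of `AtomisticToContinuum`); file of record written by
the decomp-a2c cell's lens-2 g17 seat (v2, sha256 f8100bfc…, 1163 lines, one namespace), SPLIT VERBATIM into four
modules ≤ 400 lines for the tree's file-size lint by hand-1 g5 (declarations, statements and proofs byte-identical;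
only imports / module docstrings differ):
* `RepetitiveNetworkReductionRecurrentMemberEngine` — matching calculus + the hull engine `exists_mem_uniformlyRecurrent`;
* `RepetitiveNetworkReductionRecurrentMemberDefs` — the route's `let`s as definitions, the counting-measure dictionary,
  re-rooting invariance of the good class;
* `RepetitiveNetworkReductionRecurrentMemberLimits` — far tails, convergence of field sums, closure of `Appr` / Nash
  under rooted local limits;
* `RepetitiveNetworkReductionRecurrentMember` — closure of `IsMuGSC`, `goodClass_closed`, assembly and the stub BY NAME.

This part: uniform far tails of the Lennard-Jones field over separated sets (`tsum_abs_lennardJones_le_of_far`),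
convergence of the punctured field sums along two-way matched approximants (`tendsto_tsum_lennardJones_of_matched`:
finite parts by `LocalLimitStable.tendsto_sum_lennardJones_of_matched`, far tails uniformly small), and closure under
rooted local limits of the texture clause (`apprS_of_limit`, unpacking from the root with
`FrustratedLawDichotomyTextureUnpacking.stub_textureUnpacking`) and of the Nash clause (`nashS_of_limit`). All `[folklore]`.
-/


noncomputable section

open scoped BigOperators Topology
open Filter Set Metric MeasureTheory

namespace Summit.AtomisticToContinuum.Crystallization.Theorems.RepetitiveNetworkReductionRecurrentMember

open Literature.MathematicalPhysics.StatisticalMechanics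
open Literature.Probability.Process (count_restrict_singleton_ne_zero_iff)
open Summit.AtomisticToContinuum.Crystallization.Theorems.LocalLimitStable

/-- Uniform far Lennard-Jones tails of an infinite separated set: if the points of `Y ⊆ ℝ³` are pairwise `≥ δ`
apart and all at distance `≥ T` from `w` (`T ≥ δ`, `T ≥ 1`), then `Σ'_{q ∈ Y} |V_LJ(|w − q|)| ≤ (1/4)·250 δ⁻⁵ T⁻¹`
(the finite bound `sum_abs_lennardJones_le_of_far` on every finite part). [folklore] -/
theorem tsum_abs_lennardJones_le_of_far {Y : Set (EuclideanSpace ℝ (Fin 3))} (w : EuclideanSpace ℝ (Fin 3))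
    {δ T : ℝ} (hδ : 0 < δ) (hδT : δ ≤ T) (h1T : 1 ≤ T)
    (hY : ∀ p ∈ Y, ∀ q ∈ Y, p ≠ q → δ ≤ dist p q) (hfar : ∀ q ∈ Y, T ≤ dist w q) :
    ∑' q : Y, |lennardJones (dist w (q : EuclideanSpace ℝ (Fin 3)))| ≤ 1 / 4 * (250 * δ⁻¹ ^ 5 * T⁻¹) := by
  classical
  refine Real.tsum_le_of_sum_le (fun q => abs_nonneg _) fun u => ?_
  have hsep : ∀ p ∈ u.map (Function.Embedding.subtype (· ∈ Y)), ∀ q ∈ u.map (Function.Embedding.subtype (· ∈ Y)),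
      p ≠ q → δ ≤ dist p q := by
    intro p hp q hq hpq
    obtain ⟨p', -, rfl⟩ := Finset.mem_map.1 hp
    obtain ⟨q', -, rfl⟩ := Finset.mem_map.1 hq
    exact hY _ p'.2 _ q'.2 hpq
  have hfar' : ∀ q ∈ u.map (Function.Embedding.subtype (· ∈ Y)), T ≤ dist w q := by
    intro q hq
    obtain ⟨q', -, rfl⟩ := Finset.mem_map.1 hq
    exact hfar _ q'.2
  have h := sum_abs_lennardJones_le_of_far (u.map (Function.Embedding.subtype (· ∈ Y))) w hδ hδT h1T hsep hfar'
  rwa [Finset.sum_map] at h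

/-- **Field energies converge along two-way matched sequences of (possibly infinite) separated sets.** Let `X' ⊆ ℝ³`
be `δ`-separated and `w₀` at distance `≥ ρ₀ > 0` from `X'`; let `T_j ⊆ ℝ³` be `δ`-separated sets which are, for every
radius `R` and every `ε > 0`, eventually two-way `ε`-matched with `X'` on the ball `B_R(w₀)`, and let `w_j → w₀`.
Then `Σ'_{q ∈ T_j} V_LJ(|w_j − q|) → Σ'_{q ∈ X'} V_LJ(|w₀ − q|)`: the finite parts `T_j ∩ B̄_j(w₀)` converge by
`tendsto_sum_lennardJones_of_matched`, and the rest is a uniform far tail `≤ (1/4)·250 δ⁻⁵/(j − 1)`. [folklore] -/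
theorem tendsto_tsum_lennardJones_of_matched {X' : Set (EuclideanSpace ℝ (Fin 3))} {δ : ℝ} (hδ : 0 < δ)
    (hX' : ∀ p ∈ X', ∀ q ∈ X', p ≠ q → δ ≤ dist p q)
    {w₀ : EuclideanSpace ℝ (Fin 3)} {ρ₀ : ℝ} (hρ₀ : 0 < ρ₀) (hw₀ : ∀ q ∈ X', ρ₀ ≤ dist w₀ q)
    {T : ℕ → Set (EuclideanSpace ℝ (Fin 3))} (hT : ∀ j, ∀ p ∈ T j, ∀ q ∈ T j, p ≠ q → δ ≤ dist p q)
    {w : ℕ → EuclideanSpace ℝ (Fin 3)} (hw : Tendsto w atTop (𝓝 w₀))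
    (hmatch : ∀ R ε : ℝ, 0 < ε → ∀ᶠ j in atTop,
      (∀ p ∈ X', dist p w₀ ≤ R → ∃ q ∈ T j, dist q p ≤ ε) ∧
        (∀ q ∈ T j, dist q w₀ ≤ R → ∃ p ∈ X', dist q p ≤ ε)) :
    Tendsto (fun j => ∑' q : ↥(T j), lennardJones (dist (w j) (q : EuclideanSpace ℝ (Fin 3)))) atTop
      (𝓝 (∑' q : X', lennardJones (dist w₀ (q : EuclideanSpace ℝ (Fin 3))))) := by
  classical
  -- the near parts `T j ∩ B̄_j(w₀)`
  have hfin : ∀ j : ℕ, (T j ∩ closedBall w₀ (j : ℝ)).Finite := fun j =>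
    finite_of_forall_le_dist_of_subset_closedBall hδ (fun p hp q hq hpq => hT j p hp.1 q hq.1 hpq)
      Set.inter_subset_right
  obtain ⟨S, hS⟩ : ∃ S : ℕ → Finset (EuclideanSpace ℝ (Fin 3)), ∀ j, S j = (hfin j).toFinset := ⟨_, fun _ => rfl⟩
  have hmemS : ∀ j q, q ∈ S j ↔ q ∈ T j ∧ dist q w₀ ≤ j := fun j q => by
    rw [hS j, Set.Finite.mem_toFinset, Set.mem_inter_iff, mem_closedBall]
  have hcoeS : ∀ j, ((S j : Set (EuclideanSpace ℝ (Fin 3)))) = T j ∩ closedBall w₀ (j : ℝ) := fun j => by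
    rw [hS j, Set.Finite.coe_toFinset]
  have hSsep : ∀ j, ∀ p ∈ S j, ∀ q ∈ S j, p ≠ q → δ ≤ dist p q := fun j p hp q hq hpq =>
    hT j p ((hmemS j p).1 hp).1 q ((hmemS j q).1 hq).1 hpq
  have hSmatch : ∀ R ε : ℝ, 0 < ε → ∀ᶠ j in atTop,
      (∀ p ∈ X', dist p w₀ ≤ R → ∃ q ∈ S j, dist q p ≤ ε) ∧
        (∀ q ∈ S j, dist q w₀ ≤ R → ∃ p ∈ X', dist q p ≤ ε) := by
    intro R ε hε
    have hev : ∀ᶠ j : ℕ in atTop, R + ε ≤ (j : ℝ) := by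
      filter_upwards [Filter.eventually_ge_atTop ⌈R + ε⌉₊] with j hj
      exact (Nat.le_ceil _).trans (by exact_mod_cast hj)
    filter_upwards [hmatch R ε hε, hev] with j hj hjR
    refine ⟨fun p hp hpR => ?_, fun q hq hqR => hj.2 q ((hmemS j q).1 hq).1 hqR⟩
    obtain ⟨q, hq, hqp⟩ := hj.1 p hp hpR
    refine ⟨q, (hmemS j q).2 ⟨hq, ?_⟩, hqp⟩
    calc dist q w₀ ≤ dist q p + dist p w₀ := dist_triangle _ _ _
      _ ≤ ε + R := add_le_add hqp hpR
      _ ≤ j := by linarith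
  have hnear := tendsto_sum_lennardJones_of_matched hδ hX' hρ₀ hw₀ hSsep hw hSmatch
  -- the far parts
  set C : ℝ := 1 / 4 * (250 * δ⁻¹ ^ 5) with hC
  have hsplit : ∀ j : ℕ, δ + 2 ≤ (j : ℝ) → dist (w j) w₀ ≤ 1 →
      |∑' q : ↥(T j), lennardJones (dist (w j) (q : EuclideanSpace ℝ (Fin 3))) -
        ∑ q ∈ S j, lennardJones (dist (w j) q)| ≤ C * ((j : ℝ) - 1)⁻¹ := by
    intro j hj hwj
    set f : EuclideanSpace ℝ (Fin 3) → ℝ := fun q => lennardJones (dist (w j) q) with hf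
    have hsumm : ∀ Y : Set (EuclideanSpace ℝ (Fin 3)), Y ⊆ T j →
        Summable (f ∘ (↑) : Y → ℝ) := fun Y hY =>
      UniformlyDiscrete.summable_lennardJones_dist ⟨δ, hδ, fun p hp q hq hpq => hT j p (hY hp) q (hY hq) hpq⟩ (w j)
    have hdisj : Disjoint (T j ∩ closedBall w₀ (j : ℝ)) (T j \ closedBall w₀ (j : ℝ)) :=
      Set.disjoint_left.2 fun q hq hq' => hq'.2 hq.2
    have h1 : ∑' q : ↥(T j), f q =
        ∑' q : ↥(T j ∩ closedBall w₀ (j : ℝ)), f q + ∑' q : ↥(T j \ closedBall w₀ (j : ℝ)), f q := by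
      rw [← Summable.tsum_union_disjoint hdisj (hsumm _ Set.inter_subset_left) (hsumm _ Set.sdiff_subset)]
      exact tsum_congr_set_coe f (Set.inter_union_sdiff (T j) (closedBall w₀ (j : ℝ))).symm
    have h2 : ∑' q : ↥(T j ∩ closedBall w₀ (j : ℝ)), f q = ∑ q ∈ S j, f q := by
      rw [← Finset.tsum_subtype' (S j) f]
      exact tsum_congr_set_coe f (hcoeS j).symm
    rw [h1, h2, add_sub_cancel_left]
    have hfarj : ∀ q ∈ T j \ closedBall w₀ (j : ℝ), (j : ℝ) - 1 ≤ dist (w j) q := by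
      intro q hq
      have hq' : (j : ℝ) < dist q w₀ := not_le.1 fun h => hq.2 (mem_closedBall.2 h)
      have := dist_triangle q (w j) w₀
      rw [dist_comm q (w j)] at this
      linarith
    have hsep' : ∀ p ∈ T j \ closedBall w₀ (j : ℝ), ∀ q ∈ T j \ closedBall w₀ (j : ℝ), p ≠ q → δ ≤ dist p q :=
      fun p hp q hq hpq => hT j p hp.1 q hq.1 hpq
    have htail := tsum_abs_lennardJones_le_of_far (w j) hδ (by linarith) (by linarith) hsep' hfarj
    have habs : Summable fun q : ↥(T j \ closedBall w₀ (j : ℝ)) => ‖f q‖ :=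
      ((hsumm _ Set.sdiff_subset).abs).congr fun q => (Real.norm_eq_abs _).symm
    calc |∑' q : ↥(T j \ closedBall w₀ (j : ℝ)), f q|
        = ‖∑' q : ↥(T j \ closedBall w₀ (j : ℝ)), f q‖ := (Real.norm_eq_abs _).symm
      _ ≤ ∑' q : ↥(T j \ closedBall w₀ (j : ℝ)), ‖f q‖ := norm_tsum_le_tsum_norm habs
      _ = ∑' q : ↥(T j \ closedBall w₀ (j : ℝ)), |f q| := by simp only [Real.norm_eq_abs]
      _ ≤ 1 / 4 * (250 * δ⁻¹ ^ 5 * ((j : ℝ) - 1)⁻¹) := htail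
      _ = C * ((j : ℝ) - 1)⁻¹ := by rw [hC]; ring
  have hfar : Tendsto (fun j => ∑' q : ↥(T j), lennardJones (dist (w j) (q : EuclideanSpace ℝ (Fin 3))) -
      ∑ q ∈ S j, lennardJones (dist (w j) q)) atTop (𝓝 0) := by
    have hev1 : ∀ᶠ j : ℕ in atTop, δ + 2 ≤ (j : ℝ) := by
      filter_upwards [Filter.eventually_ge_atTop ⌈δ + 2⌉₊] with j hj
      exact (Nat.le_ceil _).trans (by exact_mod_cast hj)
    have hev2 : ∀ᶠ j : ℕ in atTop, dist (w j) w₀ ≤ 1 :=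
      ((Metric.tendsto_nhds.1 hw) 1 one_pos).mono fun j hj => hj.le
    have hlim : Tendsto (fun j : ℕ => C * ((j : ℝ) - 1)⁻¹) atTop (𝓝 0) := by
      have h1 : Tendsto (fun j : ℕ => (j : ℝ) - 1) atTop atTop :=
        tendsto_atTop_add_const_right atTop (-1) tendsto_natCast_atTop_atTop
      have h2 := tendsto_inv_atTop_zero.comp h1
      simpa using h2.const_mul C
    refine squeeze_zero_norm' ?_ hlim
    filter_upwards [hev1, hev2] with j hj1 hj2
    rw [Real.norm_eq_abs]
    exact hsplit j hj1 hj2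
  have hsum := hnear.add hfar
  rw [add_zero] at hsum
  refine hsum.congr fun j => ?_
  ring

/-! ## Closure of the class under local limits -/

/-- `TexBall` is monotone in the radius (each clause is guarded by the distance to the centre). [folklore] -/
theorem texBall_mono {N : ℕ} {y : Fin N → EuclideanSpace ℝ (Fin 3)} {i : Fin N} {R R' R₇ R₈ R₉ : ℝ}
    (h : TexBall N y i R' R₇ R₈ R₉) (hR : R ≤ R') : TexBall N y i R R₇ R₈ R₉ := by
  obtain ⟨h1, h2, h3, h4, h5⟩ := h
  exact ⟨h1, fun j hj => h2 j (hj.trans hR), fun j hj => h3 j (hj.trans hR), fun j hj => h4 j (hj.trans hR),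
    fun j hj => h5 j (hj.trans hR)⟩

/-- `‖(p₁ - a) - p‖ ≤ dist p₁ p + ‖a‖`. [folklore] -/
theorem dist_sub_le_dist_add_norm (p₁ a p : EuclideanSpace ℝ (Fin 3)) :
    dist (p₁ - a) p ≤ dist p₁ p + dist a 0 := by
  rw [dist_eq_norm, dist_eq_norm, dist_zero_right]
  calc ‖p₁ - a - p‖ = ‖(p₁ - p) - a‖ := by congr 1; abel
    _ ≤ ‖p₁ - p‖ + ‖a‖ := norm_sub_le _ _

/-- **`Appr` passes to local limits** (recentre the textured balls of a near approximant at the atom matched to the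
root, then unpack from the root to every atom by `stub_textureUnpacking`). [folklore] -/
theorem apprS_of_limit {R₇ R₈ R₉ : ℝ} {Zs : ℕ → Set (EuclideanSpace ℝ (Fin 3))} (hZA : ∀ k, ApprS (Zs k) R₇ R₈ R₉)
    {Z : Set (EuclideanSpace ℝ (Fin 3))} (h0 : (0 : EuclideanSpace ℝ (Fin 3)) ∈ Z)
    (hconv : ∀ R ε : ℝ, 0 < ε → ∀ᶠ k in atTop, BallMatch ε R 0 (Zs k) Z) : ApprS Z R₇ R₈ R₉ := by
  -- matching about the root
  have hroot : ∀ R ε : ℝ, 0 < ε → ∃ (N : ℕ) (w : Fin N → EuclideanSpace ℝ (Fin 3)) (j : Fin N),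
      TexBall N w j R R₇ R₈ R₉ ∧
      (∀ p ∈ Z, ‖p‖ ≤ R → ∃ k : Fin N, dist (w k - w j) p ≤ ε) ∧
      (∀ k : Fin N, dist (w k) (w j) ≤ R → ∃ p ∈ Z, dist (w k - w j) p ≤ ε) := by
    intro R ε hε
    set η : ℝ := min ε 1 / 4 with hη
    have hmin0 : 0 < min ε 1 := lt_min hε one_pos
    have hη0 : 0 < η := by rw [hη]; positivity
    have hηε : 3 * η ≤ ε := by
      have := min_le_left ε 1
      rw [hη]; linarith
    have hη1 : 2 * η ≤ 1 := by
      have := min_le_right ε 1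
      rw [hη]; linarith
    have hRabs : R ≤ |R| := le_abs_self R
    obtain ⟨k, hk⟩ := (hconv (|R| + 2) η hη0).exists
    obtain ⟨a, ha, ha0⟩ := hk.1 0 h0 (by rw [dist_self]; positivity)
    obtain ⟨N, y, i, hT, hM1, hM2⟩ := hZA k a ha (|R| + 1) η hη0
    refine ⟨N, y, i, texBall_mono hT (by linarith), fun p hp hpR => ?_, fun k' hk' => ?_⟩
    · have hp0 : dist p (0 : EuclideanSpace ℝ (Fin 3)) ≤ |R| + 2 := by
        rw [dist_zero_right]; linarith
      obtain ⟨p₁, hp₁, hp₁p⟩ := hk.1 p hp hp0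
      have hp₁a : dist p₁ a ≤ |R| + 1 := by
        have h1 := dist_triangle p₁ p a
        have h2 := dist_triangle p (0 : EuclideanSpace ℝ (Fin 3)) a
        rw [dist_zero_right, dist_comm (0 : EuclideanSpace ℝ (Fin 3)) a] at h2
        linarith
      obtain ⟨k', hk'⟩ := hM1 p₁ hp₁ hp₁a
      refine ⟨k', ?_⟩
      calc dist (y k' - y i) p ≤ dist (y k' - y i) (p₁ - a) + dist (p₁ - a) p := dist_triangle _ _ _
        _ ≤ η + (dist p₁ p + dist a 0) := add_le_add hk' (dist_sub_le_dist_add_norm p₁ a p)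
        _ ≤ η + (η + η) := by linarith
        _ ≤ ε := by linarith
    · have hk'R : dist (y k') (y i) ≤ |R| + 1 := hk'.trans (by linarith)
      obtain ⟨p₁, hp₁, hkp₁⟩ := hM2 k' hk'R
      have hp₁0 : dist p₁ (0 : EuclideanSpace ℝ (Fin 3)) ≤ |R| + 2 := by
        have h1 := FrustratedLawDichotomyTextureUnpacking.norm_le_dist_add_norm p₁ a
        have h2 := FrustratedLawDichotomyTextureUnpacking.norm_le_dist_add_norm (p₁ - a) (y k' - y i)
        have ha0' : ‖a‖ ≤ η := by
          have := ha0
          rwa [dist_zero_right] at this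
        have e1 : dist p₁ a = ‖p₁ - a‖ := dist_eq_norm _ _
        have e2 : ‖y k' - y i‖ = dist (y k') (y i) := (dist_eq_norm _ _).symm
        have e3 : dist (p₁ - a) (y k' - y i) = dist (y k' - y i) (p₁ - a) := dist_comm _ _
        rw [dist_zero_right]
        linarith
      obtain ⟨p, hp, hp₁p⟩ := hk.2 p₁ hp₁ hp₁0
      refine ⟨p, hp, ?_⟩
      calc dist (y k' - y i) p ≤ dist (y k' - y i) (p₁ - a) + dist (p₁ - a) p := dist_triangle _ _ _
        _ ≤ η + (dist p₁ p + dist a 0) := add_le_add hkp₁ (dist_sub_le_dist_add_norm p₁ a p)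
        _ ≤ η + (η + η) := by linarith
        _ ≤ ε := by linarith
  -- unpack from the root to every atom
  have h := FrustratedLawDichotomyTextureUnpacking.stub_textureUnpacking
    ((Measure.count : Measure (EuclideanSpace ℝ (Fin 3))).restrict Z) R₇ R₈ R₉
  have hrootM : ∀ R ε : ℝ, 0 < ε → ∃ (N : ℕ) (w : Fin N → EuclideanSpace ℝ (Fin 3)) (j : Fin N),
      TexBall N w j R R₇ R₈ R₉ ∧
      (∀ p : EuclideanSpace ℝ (Fin 3), (Measure.count : Measure (EuclideanSpace ℝ (Fin 3))).restrict Z {p} ≠ 0 →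
        ‖p‖ ≤ R → ∃ k : Fin N, dist (w k - w j) p ≤ ε) ∧
      (∀ k : Fin N, dist (w k) (w j) ≤ R → ∃ p : EuclideanSpace ℝ (Fin 3),
        (Measure.count : Measure (EuclideanSpace ℝ (Fin 3))).restrict Z {p} ≠ 0 ∧ dist (w k - w j) p ≤ ε) := by
    intro R ε hε
    obtain ⟨N, w, j, hT, h1, h2⟩ := hroot R ε hε
    refine ⟨N, w, j, hT, fun p hp => h1 p ((count_restrict_singleton_ne_zero_iff Z p).1 hp), fun k hk => ?_⟩
    obtain ⟨p, hp, hkp⟩ := h2 k hk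
    exact ⟨p, (count_restrict_singleton_ne_zero_iff Z p).2 hp, hkp⟩
  have hA : ApprM ((Measure.count : Measure (EuclideanSpace ℝ (Fin 3))).restrict Z) R₇ R₈ R₉ := h hrootM
  exact (apprM_iff Z R₇ R₈ R₉).1 hA

/-- A sequence at distance `≤ 1/(m+1)` from `p` converges to `p`. [folklore] -/
theorem tendsto_of_dist_le_one_div {u : ℕ → EuclideanSpace ℝ (Fin 3)} {p : EuclideanSpace ℝ (Fin 3)}
    (h : ∀ m : ℕ, dist (u m) p ≤ 1 / ((m : ℝ) + 1)) : Tendsto u atTop (𝓝 p) := by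
  rw [tendsto_iff_dist_tendsto_zero]
  exact squeeze_zero (fun m => dist_nonneg) h tendsto_one_div_add_atTop_nhds_zero_nat

/-- **The Nash (single-move) condition passes to local limits of separated configurations.** [folklore]
For `p ∈ Z` and a competitor position `y ∉ Z \ {p}`: match `p` to atoms `p_m` of near approximants, perturb `y` to
`y_m` off the (locally finite) approximant, apply the Nash inequality there, and pass to the limit in both field sums
with `tendsto_tsum_lennardJones_of_matched` (the punctured configurations are two-way matched because `2/(m+1) < δ`
forces the atom matched to `p` to be `p_m`). -/
theorem nashS_of_limit {δ : ℝ} (hδ : 0 < δ) {Zs : ℕ → Set (EuclideanSpace ℝ (Fin 3))}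
    (hZsep : ∀ k, ∀ p ∈ Zs k, ∀ q ∈ Zs k, p ≠ q → δ ≤ dist p q) (hZN : ∀ k, NashS (Zs k))
    {Z : Set (EuclideanSpace ℝ (Fin 3))} (hsep : ∀ p ∈ Z, ∀ q ∈ Z, p ≠ q → δ ≤ dist p q)
    (hconv : ∀ R ε : ℝ, 0 < ε → ∀ᶠ k in atTop, BallMatch ε R 0 (Zs k) Z) : NashS Z := by
  classical
  intro p hp y hy
  by_cases hyp : y = p
  · rw [hyp]
  have hype : y - p ≠ 0 := sub_ne_zero.2 hyp
  -- scales, indices, matched atoms and perturbed competitors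
  have hε : ∀ m : ℕ, (0 : ℝ) < 1 / ((m : ℝ) + 1) := fun m => by positivity
  obtain ⟨κ, hκ⟩ : ∃ κ : ℕ → ℕ, ∀ m : ℕ,
      BallMatch (1 / ((m : ℝ) + 1)) ((m : ℝ) + ‖p‖ + ‖y‖ + 1) 0 (Zs (κ m)) Z :=
    ⟨fun m => (hconv ((m : ℝ) + ‖p‖ + ‖y‖ + 1) _ (hε m)).exists.choose,
      fun m => (hconv ((m : ℝ) + ‖p‖ + ‖y‖ + 1) _ (hε m)).exists.choose_spec⟩
  have hp0 : ∀ m : ℕ, dist p (0 : EuclideanSpace ℝ (Fin 3)) ≤ (m : ℝ) + ‖p‖ + ‖y‖ + 1 := fun m => by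
    rw [dist_zero_right]
    have : (0 : ℝ) ≤ m := Nat.cast_nonneg m
    linarith [norm_nonneg y]
  obtain ⟨pm, hpmZ, hpm⟩ : ∃ pm : ℕ → EuclideanSpace ℝ (Fin 3), (∀ m, pm m ∈ Zs (κ m)) ∧
      ∀ m : ℕ, dist (pm m) p ≤ 1 / ((m : ℝ) + 1) := by
    choose pm h1 h2 using fun m : ℕ => (hκ m).1 p hp (hp0 m)
    exact ⟨pm, h1, h2⟩
  have hfinY : ∀ m : ℕ, (Zs (κ m) ∩ closedBall y 1).Finite := fun m =>
    finite_of_forall_le_dist_of_subset_closedBall hδ (fun a ha b hb hab => hZsep _ a ha.1 b hb.1 hab)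
      Set.inter_subset_right
  obtain ⟨ym, hymd, hymZ⟩ : ∃ ym : ℕ → EuclideanSpace ℝ (Fin 3),
      (∀ m : ℕ, dist (ym m) y < 1 / ((m : ℝ) + 1)) ∧ ∀ m, ∀ q ∈ Zs (κ m), q ≠ pm m → ym m ≠ q := by
    choose ym h1 h2 using fun m : ℕ =>
      FrustratedLawDichotomyNashAtLocalLimits.exists_near_not_mem_finset y hype
        (lt_min (hε m) one_pos) (hfinY m).toFinset
    refine ⟨ym, fun m => (h1 m).trans_le (min_le_left _ _), fun m q hq _ h => h2 m ?_⟩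
    rw [Set.Finite.mem_toFinset]
    refine ⟨h ▸ hq, mem_closedBall.2 ?_⟩
    exact ((h1 m).trans_le (min_le_right _ _)).le
  -- the Nash inequality at stage `m`
  have hstage : ∀ m : ℕ,
      ∑' q : ↥(Zs (κ m) \ {pm m}), lennardJones (dist (pm m) (q : EuclideanSpace ℝ (Fin 3))) ≤
        ∑' q : ↥(Zs (κ m) \ {pm m}), lennardJones (dist (ym m) (q : EuclideanSpace ℝ (Fin 3))) :=
    fun m => hZN (κ m) (pm m) (hpmZ m) (ym m) (hymZ m)
  -- two-way matching of the punctured configurations about any centre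
  have hX'sep : ∀ a ∈ Z \ {p}, ∀ b ∈ Z \ {p}, a ≠ b → δ ≤ dist a b :=
    fun a ha b hb hab => hsep a ha.1 b hb.1 hab
  have hTsep : ∀ m, ∀ a ∈ Zs (κ m) \ {pm m}, ∀ b ∈ Zs (κ m) \ {pm m}, a ≠ b → δ ≤ dist a b :=
    fun m a ha b hb hab => hZsep _ a ha.1 b hb.1 hab
  have hmatch : ∀ c : EuclideanSpace ℝ (Fin 3), ∀ R e : ℝ, 0 < e → ∀ᶠ m : ℕ in atTop,
      (∀ q ∈ Z \ {p}, dist q c ≤ R → ∃ q' ∈ Zs (κ m) \ {pm m}, dist q' q ≤ e) ∧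
        (∀ q' ∈ Zs (κ m) \ {pm m}, dist q' c ≤ R → ∃ q ∈ Z \ {p}, dist q' q ≤ e) := by
    intro c R e he
    filter_upwards [(tendsto_one_div_add_atTop_nhds_zero_nat.eventually (gt_mem_nhds (lt_min he (half_pos hδ)))), (tendsto_natCast_atTop_atTop.eventually_ge_atTop (R + ‖c‖))]
      with m hm1 hm2
    have hme : 1 / ((m : ℝ) + 1) ≤ e := (hm1.trans_le (min_le_left _ _)).le
    have hmδ : 2 * (1 / ((m : ℝ) + 1)) < δ := by
      have := hm1.trans_le (min_le_right _ _); linarith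
    have hrad : ∀ q : EuclideanSpace ℝ (Fin 3), dist q c ≤ R →
        dist q (0 : EuclideanSpace ℝ (Fin 3)) ≤ (m : ℝ) + ‖p‖ + ‖y‖ + 1 := by
      intro q hqc
      have h1 := dist_triangle q c (0 : EuclideanSpace ℝ (Fin 3))
      have e1 : dist c (0 : EuclideanSpace ℝ (Fin 3)) = ‖c‖ := dist_zero_right _
      linarith [norm_nonneg p, norm_nonneg y]
    refine ⟨fun q hq hqc => ?_, fun q' hq' hq'c => ?_⟩
    · obtain ⟨q', hq', hq'q⟩ := (hκ m).1 q hq.1 (hrad q hqc)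
      have hne : q' ≠ pm m := by
        intro hq'e
        have hqp : q ≠ p := fun h => hq.2 (Set.mem_singleton_iff.2 h)
        have h3 := hsep q hq.1 p hp hqp
        have : dist q p ≤ 2 * (1 / ((m : ℝ) + 1)) :=
          calc dist q p ≤ dist q' q + dist q' p := dist_triangle_left _ _ _
            _ ≤ 1 / ((m : ℝ) + 1) + 1 / ((m : ℝ) + 1) := add_le_add hq'q (hq'e ▸ hpm m)
            _ = 2 * (1 / ((m : ℝ) + 1)) := by ring
        linarith
      exact ⟨q', ⟨hq', fun h => hne (Set.mem_singleton_iff.1 h)⟩, hq'q.trans hme⟩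
    · obtain ⟨q, hq, hq'q⟩ := (hκ m).2 q' hq'.1 (hrad q' hq'c)
      have hqp : q ≠ p := by
        intro hqp
        have hne : q' ≠ pm m := fun h => hq'.2 (Set.mem_singleton_iff.2 h)
        have h3 := hZsep (κ m) q' hq'.1 (pm m) (hpmZ m) hne
        have : dist q' (pm m) ≤ 2 * (1 / ((m : ℝ) + 1)) :=
          calc dist q' (pm m) ≤ dist q' q + dist (pm m) q := dist_triangle_right _ _ _
            _ ≤ 1 / ((m : ℝ) + 1) + 1 / ((m : ℝ) + 1) := add_le_add hq'q (hqp ▸ hpm m)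
            _ = 2 * (1 / ((m : ℝ) + 1)) := by ring
        linarith
      exact ⟨q, ⟨hq, fun h => hqp (Set.mem_singleton_iff.1 h)⟩, hq'q.trans hme⟩
  -- limits of both sides
  have hpt : Tendsto pm atTop (𝓝 p) := tendsto_of_dist_le_one_div hpm
  have hyt : Tendsto ym atTop (𝓝 y) := tendsto_of_dist_le_one_div fun m => (hymd m).le
  have hρp : ∀ q ∈ Z \ {p}, δ ≤ dist p q :=
    fun q hq => hsep p hp q hq.1 fun h => hq.2 (Set.mem_singleton_iff.2 h.symm)
  have hyX : y ∉ Z \ {p} := fun h => hy y h.1 (fun h' => h.2 (Set.mem_singleton_iff.2 h')) rfl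
  obtain ⟨ρy, hρy, hρyX⟩ := exists_pos_le_dist_of_not_mem hδ hX'sep hyX
  have hlimA := tendsto_tsum_lennardJones_of_matched hδ hX'sep hδ hρp hTsep hpt (hmatch p)
  have hlimB := tendsto_tsum_lennardJones_of_matched hδ hX'sep hρy hρyX hTsep hyt (hmatch y)
  exact le_of_tendsto_of_tendsto' hlimA hlimB hstage


end Summit.AtomisticToContinuum.Crystallization.Theorems.RepetitiveNetworkReductionRecurrentMember
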